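import Summits.ResolutionOfSingularities.ResolutionOfSingularities.Theorems.HomologicalConductorNoZenoH0BaseChange
import Summits.ResolutionOfSingularities.ResolutionOfSingularities.Theorems.HomologicalConductorNoZenoPointBlowupNode
import Summits.ResolutionOfSingularities.ResolutionOfSingularities.Theorems.HomologicalConductorNoZenoExcCurvesLocalization
import Literature.AlgebraicGeometry.Morphisms.CechH1LengthComparison
import Literature.AlgebraicGeometry.Resolution.MarkedIdealsLemmas
import Literature.AlgebraicGeometry.Resolution.AlterationsNodalBoundary
import Literature.AlgebraicGeometry.Motives.ClosedSubvarietyOfPoint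
import HarnessLib

/-!
# Crux `NoZenoR` (stmt-ResolutionOfSingularities-19943), slot 5 `stub_L1wCoreF3`, (B1) UP-5c:
# TRANSPORT OF LIPMAN'S `h⁰`-LENGTHS (AND OF «FIRST KIND») TO THE GERM RESOLUTION

OURS (cell res-hironaka, crux chain W4.4, seat res-L0-w44-stub-1 g12; the by-signature numerical input
«first kind: stub-1 UP-5» of step (2) of the lead's closer skeleton `L1wCoreCloser-SKELETON.lean`
d2cae9e6707cd6ee). Nothing here is a statement of the manuscript under review (Hironaka 2017); AI-written,
weaker than expert review. Def-free, fact-free, `--supports 19943 --as helper`.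

THE GAP IT CLOSES. UP-5 (`…PointBlowupRegularPoint`, `…PointBlowupNode`) proves the first-kind identity
`h0 π¹ (𝓘_η ^ 2) = 3 * h0 π¹ 𝓘_η` for the node curves `E_η` of `X¹ = Bl_{nodes} X` with `h0` taken over the
base `S` of `π¹ : X¹ → Spec S`. The closer applies `Lipman1969_27_1_reg_rat` NOT over `S` but over the GERM
`N' = N_𝔮` of the chart ring `N ⊇ S` at a closed point `𝔮` over `𝔪_S`, to the resolution
`ψ = pullback.snd σ g : V ×_N Spec N' → Spec N'` of `Spec N'` (`σ : V → Spec N` the chart resolution on an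
open `V ⊆ X¹`, `g = Spec (N → N')`; currency of `…ExcCurvesLocalization.excCurvePoints_pullback_snd_localization`).
Two things change: the ideal (`𝓘_η` ↦ its inverse image along `pullback.fst σ g`, which IS the prime divisor
ideal of the point `ζ` over `η`), and the base of the lengths (`S` ↦ `N'`: every length gets divided by the
residue degree `[κ(𝔮) : κ(𝔪_S)]`). This file proves:

* §1 `length_sections_comp_specMap`, **`h0_comp_specMap`** — change of LOCAL base along a local
  homomorphism `S → N'`: `h0 (f ≫ Spec(S → N')) 𝓙 = h0 f 𝓙 * [κ(N') : κ(S)]`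
  (Mathlib `IsLocalRing.length_restrictScalars`; the factor is `Module.length κ(S) κ(N')`).
* §2 `isUnit_algebraMapΓ_of_notMem`, **`exists_fac_specMap_localization`**, `isPullback_id_of_fac` — a scheme
  `τ : E → Spec N` all of whose points lie over generizations of `𝔮` factors (uniquely) through the
  preimmersion `g : Spec N_𝔮 → Spec N`, and then `E ×_N Spec N_𝔮 = E` (`IsPullback (𝟙 E) τ₁ τ g`).
* §3 **`h0_comap_fst_localization_mul`** — for an ideal sheaf `𝓙` on `V` co-supported over `𝔮`:
  `h0 ψ (𝓙.comap (pullback.fst σ g)) * [κ(N') : κ(S)] = h0 (σ ≫ Spec(S → N)) 𝓙`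
  (stub-2's `isPullback_subscheme_comap` p555337 + §2: `V(𝓙·𝒪) ≅ V(𝓙)` over `Spec N'`).
* (sequel `…NoZenoFirstKindGerm`: the ideal identification `fst*𝓘_z = 𝓘_ζ` and the cancelled first-kind
  statement `h0 ψ (𝓘_ζ ^ 2) = 3 * h0 ψ 𝓘_ζ`, the literal hypothesis of `Lipman1969_27_1_reg_rat` for `ψ`.)

References: J. Lipman, Publ. Math. IHÉS 36 (1969) §10 p. 212 (`h⁰` as a length over the base), §27
(27.1) [`Lipman1969`] (context); The Stacks Project, Tag 02KH (flat base change, degree 0), Tag 01J3.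
-/

noncomputable section

-- single-problem summit: the doubled namespace component `ResolutionOfSingularities` is forced
set_option linter.dupNamespace false

namespace Summit.ResolutionOfSingularities.ResolutionOfSingularities.Theorems.NoZeno.ExcCount

open CategoryTheory AlgebraicGeometry Limits TopologicalSpace Topology Opposite IsLocalRing
open Literature.AlgebraicGeometry.Morphisms Literature.AlgebraicGeometry.Resolution
open Scheme.IdealSheafData

universe u

/-! ## §1 Change of local base: lengths over `S` versus lengths over `N'` -/

section BaseRing

variable {S N' : Type u} [CommRing S] [CommRing N'] [Algebra S N'] {Y : Scheme.{u}}
  (f : Y ⟶ Spec (.of N'))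

/-- **Restriction of scalars along a local homomorphism multiplies lengths of sections by the residue
degree**: for `S → N'` a local homomorphism of local rings and `f : Y → Spec N'`,
`length_S Γ(Y, V) = length_{N'} Γ(Y, V) * [κ(N') : κ(S)]`, the `S`-structure being the one through
`f ≫ Spec(S → N')` (Mathlib `IsLocalRing.length_restrictScalars`). [folklore] -/
theorem length_sections_comp_specMap [IsLocalRing S] [IsLocalRing N'] [IsLocalHom (algebraMap S N')]
    (V : Y.Opens) :
    Module.length S (Sections (f ≫ Spec.map (CommRingCat.ofHom (algebraMap S N'))) V) =
      Module.length N' (Sections f V) * Module.length (ResidueField S) (ResidueField N') := by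
  -- `S` acts on `Γ(Y, V)` (structure through `f`) via `S → N'`
  letI : Module S (Sections f V) := Module.compHom _ (algebraMap S N')
  haveI : IsScalarTower S N' (Sections f V) := IsScalarTower.of_algebraMap_smul fun _ _ => rfl
  -- the identity is an `S`-linear isomorphism between the two `S`-structures
  let e : Sections (f ≫ Spec.map (CommRingCat.ofHom (algebraMap S N'))) V ≃ₗ[S] Sections f V :=
    { AddEquiv.refl _ with
      map_smul' := fun s x =>
        congrArg (fun t : Γ(Y, V) => t * (show Γ(Y, V) from x))
          (algebraMap_sections_comp (algebraMap S N') f V s) }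
  rw [e.length_eq, IsLocalRing.length_restrictScalars S N' (Sections f V)]

/-- **`h⁰` over `S` is `h⁰` over `N'` times the residue degree**: for `S → N'` a local homomorphism of
local rings, `f : Y → Spec N'` and any ideal sheaf `𝓙` on `Y`,
`h0 (f ≫ Spec(S → N')) 𝓙 = h0 f 𝓙 * [κ(N') : κ(S)]` (Lipman's `h⁰` is a length over the base, §10
p. 212; the factor is `Module.length κ(S) κ(N') = [κ(N') : κ(S)]`). [folklore] -/
theorem h0_comp_specMap [IsLocalRing S] [IsLocalRing N'] [IsLocalHom (algebraMap S N')]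
    (𝓙 : Y.IdealSheafData) :
    h0 (f ≫ Spec.map (CommRingCat.ofHom (algebraMap S N'))) 𝓙 =
      h0 f 𝓙 * Module.length (ResidueField S) (ResidueField N') := by
  rw [h0_eq, h0_eq, ← length_sections_comp_specMap (𝓙.subschemeι ≫ f) ⊤, Category.assoc]

end BaseRing

/-! ## §2 Schemes over `Spec N` concentrated over generizations of `𝔮` factor through `Spec N_𝔮` -/

section Factor

variable {N N' : Type u} [CommRing N] [CommRing N'] [Algebra N N'] (𝔮 : Ideal N)
  {E : Scheme.{u}} (τ : E ⟶ Spec (.of N)) (hτ : ∀ e : E, (τ.base e).asIdeal ≤ 𝔮)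

include hτ in
/-- If every point of `E` lies over a generization of `𝔮`, the elements of `N ∖ 𝔮` become units in
`Γ(E, 𝒪_E)` (their germs are units everywhere). [folklore] -/
theorem isUnit_algebraMapΓ_of_notMem {s : N} (hs : s ∉ 𝔮) : IsUnit (algebraMapΓ τ s) := by
  change IsUnit (τ.appTop ((Scheme.ΓSpecIso (.of N)).inv s))
  apply E.toRingedSpace.isUnit_of_isUnit_germ ⊤
  intro e he
  apply (E.mem_basicOpen _ e he).mp
  rw [← Scheme.preimage_basicOpen_top, basicOpen_eq_of_affine]
  change s ∉ (τ.base e).asIdeal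
  exact fun h => hs (hτ e h)

variable [𝔮.IsPrime] [IsLocalization.AtPrime N' 𝔮]

include hτ in
/-- **Factorization through the localization**: a scheme `τ : E → Spec N` all of whose points lie over
generizations of the prime `𝔮` factors through `Spec N_𝔮 → Spec N` (universal property of the
localization applied to `N → Γ(E, 𝒪_E)`, then the `Γ ⊣ Spec` adjunction). [folklore] -/
theorem exists_fac_specMap_localization :
    ∃ τ₁ : E ⟶ Spec (.of N'), τ₁ ≫ Spec.map (CommRingCat.ofHom (algebraMap N N')) = τ := by
  let ℓ : N' →+* Γ(E, ⊤) :=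
    IsLocalization.lift (M := 𝔮.primeCompl) (g := algebraMapΓ τ)
      fun y => isUnit_algebraMapΓ_of_notMem 𝔮 τ hτ y.2
  refine ⟨E.toSpecΓ ≫ Spec.map (CommRingCat.ofHom ℓ), ?_⟩
  have h1 : CommRingCat.ofHom (algebraMap N N') ≫ CommRingCat.ofHom ℓ =
      CommRingCat.ofHom (algebraMapΓ τ) := by
    rw [← CommRingCat.ofHom_comp, IsLocalization.lift_comp]
  have h2 : CommRingCat.ofHom (algebraMapΓ τ) = (Scheme.ΓSpecIso (.of N)).inv ≫ τ.appTop := rfl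
  rw [Category.assoc, ← Spec.map_comp, h1, h2, Spec.map_comp, ← Scheme.toSpecΓ_naturality_assoc,
    toSpecΓ_SpecMap_ΓSpecIso_inv, Category.comp_id]

include 𝔮 in
/-- If `τ = τ₁ ≫ g` with `g = Spec(N → N_𝔮)` (a preimmersion, hence a monomorphism), then
`E ×_{Spec N} Spec N_𝔮 = E`: the square `(𝟙_E, τ₁; τ, g)` is cartesian. [folklore] -/
theorem isPullback_id_of_fac (τ₁ : E ⟶ Spec (.of N'))
    (hτ₁ : τ₁ ≫ Spec.map (CommRingCat.ofHom (algebraMap N N')) = τ) :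
    IsPullback (𝟙 E) τ₁ τ (Spec.map (CommRingCat.ofHom (algebraMap N N'))) := by
  haveI : IsPreimmersion (Spec.map (CommRingCat.ofHom (algebraMap N N'))) :=
    IsPreimmersion.of_isLocalization 𝔮.primeCompl
  exact IsPullback.of_horiz_isIso_mono ⟨by rw [Category.id_comp, hτ₁]⟩

end Factor

/-! ## §3 `h⁰` over the germ `N_𝔮` versus `h⁰` over `N ⊇ S`, for subschemes concentrated over `𝔮` -/

section Germ

variable {N N' : Type u} [CommRing N] [CommRing N'] [Algebra N N'] (𝔮 : Ideal N) [𝔮.IsMaximal]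
  [IsLocalization.AtPrime N' 𝔮] {V : Scheme.{u}} (σ : V ⟶ Spec (.of N))

/-- A point specialising FROM a point over the closed point `𝔮` lies over `𝔮` too. [folklore] -/
theorem base_eq_of_specializes {z v : V} (hz : σ.base z = ⟨𝔮, inferInstance⟩) (h : z ⤳ v) :
    σ.base v = ⟨𝔮, inferInstance⟩ := by
  have hcl : IsClosed ({(⟨𝔮, inferInstance⟩ : PrimeSpectrum N)} : Set (Spec (.of N))) :=
    (PrimeSpectrum.isClosed_singleton_iff_isMaximal _).mpr ‹𝔮.IsMaximal›
  have hsp : σ.base z ⤳ σ.base v := h.map σ.base.hom.continuous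
  rw [hz] at hsp
  exact (hsp.mem_closed hcl rfl).symm ▸ rfl

/-- The points of the integral curve `V(𝓘_z) = cl{z}` lie over `𝔮` when `z` does. [folklore] -/
theorem base_eq_of_mem_support_primeDivisorIdeal {z : V} (hz : σ.base z = ⟨𝔮, inferInstance⟩)
    {v : V} (hv : v ∈ (primeDivisorIdeal z).support) : σ.base v = ⟨𝔮, inferInstance⟩ :=
  base_eq_of_specializes 𝔮 σ hz ((mem_support_primeDivisorIdeal_iff z v).mp hv)

variable (𝓙 : V.IdealSheafData) (h𝓙 : ∀ v ∈ 𝓙.support, σ.base v = ⟨𝔮, inferInstance⟩)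

include h𝓙 in
/-- The points of `V(𝓙)` lie over (generizations of) `𝔮`. [folklore] -/
theorem asIdeal_subschemeι_le (e : ↑𝓙.subscheme) : ((𝓙.subschemeι ≫ σ).base e).asIdeal ≤ 𝔮 := by
  have hmem : 𝓙.subschemeι.base e ∈ (𝓙.support : Set V) := by
    rw [← range_subschemeι]; exact ⟨e, rfl⟩
  have h := h𝓙 _ hmem
  change (σ.base (𝓙.subschemeι.base e)).asIdeal ≤ 𝔮
  rw [h]

include 𝔮 in
/-- **`V(𝓙·𝒪_{V ×_N N_𝔮}) ≅ V(𝓙)` over `Spec N_𝔮`, on lengths**: for `𝓙` co-supported over the closed point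
`𝔮` and a factorization `τ₁ : V(𝓙) → Spec N_𝔮` of `V(𝓙) → Spec N` (`exists_fac_specMap_localization`),
`h0 ψ (𝓙.comap fst) = length_{N_𝔮} Γ(V(𝓙), 𝒪)` with `ψ = pullback.snd σ g`, `fst = pullback.fst σ g`,
`g = Spec(N → N_𝔮)` (stub-2's `isPullback_subscheme_comap` p555337 and `isPullback_id_of_fac`: two cartesian
squares on the same cospan). [folklore] -/
theorem h0_comap_fst_eq_length (τ₁ : 𝓙.subscheme ⟶ Spec (.of N'))
    (hτ₁ : τ₁ ≫ Spec.map (CommRingCat.ofHom (algebraMap N N')) = 𝓙.subschemeι ≫ σ) :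
    h0 (pullback.snd σ (Spec.map (CommRingCat.ofHom (algebraMap N N'))))
        (𝓙.comap (pullback.fst σ (Spec.map (CommRingCat.ofHom (algebraMap N N'))))) =
      Module.length N' (Sections τ₁ ⊤) := by
  have sq1 := isPullback_subscheme_comap σ
    (pullback.snd σ (Spec.map (CommRingCat.ofHom (algebraMap N N'))))
    (pullback.fst σ (Spec.map (CommRingCat.ofHom (algebraMap N N'))))
    (IsPullback.of_hasPullback σ (Spec.map (CommRingCat.ofHom (algebraMap N N')))) 𝓙
  have sq2 := isPullback_id_of_fac 𝔮 (𝓙.subschemeι ≫ σ) τ₁ hτ₁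
  let e : (𝓙.comap (pullback.fst σ (Spec.map (CommRingCat.ofHom (algebraMap N N'))))).subscheme ≅
      𝓙.subscheme := sq1.isoIsPullback _ _ sq2
  have he : e.hom ≫ τ₁ =
      (𝓙.comap (pullback.fst σ (Spec.map (CommRingCat.ofHom (algebraMap N N'))))).subschemeι ≫
        pullback.snd σ (Spec.map (CommRingCat.ofHom (algebraMap N N'))) :=
    sq1.isoIsPullback_hom_snd _ _ sq2
  let θ : Γ(𝓙.subscheme, ⊤) ≅
      Γ((𝓙.comap (pullback.fst σ (Spec.map (CommRingCat.ofHom (algebraMap N N'))))).subscheme, ⊤) :=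
    Scheme.Γ.mapIso e.op
  have hθ : θ.hom = e.hom.appTop := rfl
  rw [h0_eq]
  symm
  refine PointBlowup.length_eq_of_ringEquiv θ.commRingCatIsoToRingEquiv fun s => ?_
  change θ.hom (algebraMap N' (Sections τ₁ ⊤) s) =
    algebraMap N' (Sections
      ((𝓙.comap (pullback.fst σ (Spec.map (CommRingCat.ofHom (algebraMap N N'))))).subschemeι ≫
        pullback.snd σ (Spec.map (CommRingCat.ofHom (algebraMap N N')))) ⊤) s
  rw [hθ, PointBlowup.algebraMap_sections_top, PointBlowup.algebraMap_sections_top,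
    ← CategoryTheory.comp_apply, ← Scheme.Hom.comp_appTop, he]

include h𝓙 in
/-- **`h⁰` over the germ times the residue degree is `h⁰` over `S`.** For `S → N → N' = N_𝔮` with `S`, `N'`
local and `S → N'` a local homomorphism (`𝔮` lies over `𝔪_S`), `σ : V → Spec N`, and an ideal sheaf `𝓙` on `V`
co-supported over the closed point `𝔮`:
`h0 (pullback.snd σ g) (𝓙.comap (pullback.fst σ g)) * [κ(N') : κ(S)] = h0 (σ ≫ Spec(S → N)) 𝓙`.
So Lipman's `h⁰`-numbers of curves over `𝔮`, computed over `S` on `V` (or on any `S`-scheme containing `V`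
as an open around them, `…PointBlowupNode.h0_comap_of_isOpenImmersion`), are those of the germ resolution
`V ×_N Spec N_𝔮 → Spec N_𝔮` multiplied by the residue degree of `𝔮`. [this work] -/
theorem h0_comap_fst_localization_mul {S : Type u} [CommRing S] [IsLocalRing S] [IsLocalRing N']
    [Algebra S N] [Algebra S N'] [IsScalarTower S N N'] [IsLocalHom (algebraMap S N')] :
    h0 (pullback.snd σ (Spec.map (CommRingCat.ofHom (algebraMap N N'))))
        (𝓙.comap (pullback.fst σ (Spec.map (CommRingCat.ofHom (algebraMap N N'))))) *
        Module.length (ResidueField S) (ResidueField N') =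
      h0 (σ ≫ Spec.map (CommRingCat.ofHom (algebraMap S N))) 𝓙 := by
  obtain ⟨τ₁, hτ₁⟩ := exists_fac_specMap_localization (N' := N') 𝔮 (𝓙.subschemeι ≫ σ)
    (asIdeal_subschemeι_le 𝔮 σ 𝓙 h𝓙)
  rw [h0_comap_fst_eq_length 𝔮 σ 𝓙 τ₁ hτ₁, h0_eq]
  have key : 𝓙.subschemeι ≫ σ ≫ Spec.map (CommRingCat.ofHom (algebraMap S N)) =
      τ₁ ≫ Spec.map (CommRingCat.ofHom (algebraMap S N')) := by
    rw [← Category.assoc, ← hτ₁, Category.assoc, ← Spec.map_comp, ← CommRingCat.ofHom_comp,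
      ← IsScalarTower.algebraMap_eq]
  rw [key]
  exact (length_sections_comp_specMap τ₁ ⊤).symm

end Germ

end Summit.ResolutionOfSingularities.ResolutionOfSingularities.Theorems.NoZeno.ExcCount

end
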